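import Summits.Ventures.PercRepro.S1CFGSimpleFive

/-!
# PercRepro — THE `4`-CIRCUIT AVERAGING CAP AND THE PARAMETRISED `4`- AND `5`-SET CHAIN (p1, gen 39; feeder of S2's row `p = 12`)

For a coloop-free matroid of nullity `ν` on `n` points every single deletion `E ∖ {e}` has nullity `ν − 1` and the same
rank, so it carries at most `C(ν + 2, 4)` four-circuits (the landed circuit count on a subset); every `4`-circuit is missed by
exactly `n − 4` points, and the double count gives **`(n − 4)·c₄ ≤ n·C(ν + 2, 4)`** (`mul_ncard_fourCircuits_le`), i.e.
`c₄ ≤ ⌊n·C(ν + 2, 4)/(n − 4)⌋` (`ncard_fourCircuits_le_div`): `101` at `(ν, n) = (6, 13)` (the landed `126`), `52` at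
`(5, 12)` (`70`). With the triangle cap this sharpens the simple chain of S1CFGSimpleFive, here with the counts as PARAMETERS:
* `ncard_four_eRk_le_three_le_add` — `D₄ ≤ (n − 3)·c₃ + c₄` (no dependent pair; the landed general split);
* `four_mul_ncard_four_eRk_le_two_le_mul` — `4·Q₄² ≤ (ν − 2)·c₃` (`2 < rk E`);
* `five_mul_ncard_five_eRk_le_four_le_exact` — `5·Q₅⁴ ≤ (ν − 1)·(C(n, 4) − D₄) + (n − 4)·D₄` (`4 < rk E`; the raw double count
  with the rank-`4` `4`-sets counted exactly), and `ncard_four_subsets_eq_choose` — `#{X ⊆ E : |X| = 4} = C(n, 4)`.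
Nothing about any cell is claimed. Axioms: standard.
-/

open scoped Matroid

namespace PercRepro

namespace S1CFG

open Set S1CF

variable {α : Type}

/-- **THE `4`-CIRCUIT AVERAGING CAP**: in a coloop-free matroid of nullity `ν` on `n` points,
`(n − 4)·#{4-circuits} ≤ n·C(ν + 2, 4)`. -/
theorem mul_ncard_fourCircuits_le (M : Matroid α) [M.Finite] (hK : ∀ e, ¬ M.IsColoop e) {ν : ℕ}
    (hd : M.E.encard = M.eRank + (ν : ℕ∞)) :
    (M.E.ncard - 4) * {X : Set α | X ⊆ M.E ∧ X.ncard = 4 ∧ M.IsCircuit X}.ncard ≤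
      M.E.ncard * (ν + 2).choose 4 := by
  classical
  have hEfin := M.ground_finite
  have hnE := ncard_ground_eq_eRk_toNat_add M hd
  set E' := hEfin.toFinset with hE'
  have hmemE' : ∀ x, x ∈ E' ↔ x ∈ M.E := fun x => Set.Finite.mem_toFinset hEfin
  have hcoeE' : (E' : Set α) = M.E := Set.Finite.coe_toFinset hEfin
  have hcardE' : E'.card = M.E.ncard := (Set.ncard_eq_toFinset_card M.E hEfin).symm
  set 𝒞 := (E'.powersetCard 4).filter (fun X : Finset α => M.IsCircuit (X : Set α)) with h𝒞
  have hC : {X : Set α | X ⊆ M.E ∧ X.ncard = 4 ∧ M.IsCircuit X}.ncard = 𝒞.card :=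
    ncard_family_eq_card_filter M 4 (fun X => M.IsCircuit X)
  rw [hC, ← hcardE']
  -- the double count over the pairs `(e, C)` with `e ∉ C`
  have key := Finset.sum_card_bipartiteAbove_eq_sum_card_bipartiteBelow (s := E') (t := 𝒞)
    (fun (e : α) (C : Finset α) => e ∉ C)
  -- every circuit is missed by exactly `n − 4` points
  have hR : ∀ C ∈ 𝒞, (E'.bipartiteBelow (fun (e : α) (C : Finset α) => e ∉ C) C).card = E'.card - 4 := by
    intro C hC𝒞
    rw [h𝒞, Finset.mem_filter, Finset.mem_powersetCard] at hC𝒞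
    have : E'.bipartiteBelow (fun (e : α) (C : Finset α) => e ∉ C) C = E' \ C := by
      ext e
      rw [Finset.mem_bipartiteBelow, Finset.mem_sdiff]
    rw [this, Finset.card_sdiff_of_subset hC𝒞.1.1, hC𝒞.1.2]
  -- every point misses at most `C(ν + 2, 4)` circuits
  have hL : ∀ e ∈ E', (𝒞.bipartiteAbove (fun (e : α) (C : Finset α) => e ∉ C) e).card ≤ (ν + 2).choose 4 := by
    intro e heE'
    have heE : e ∈ M.E := (hmemE' e).1 heE'
    have hfam : (𝒞.bipartiteAbove (fun (e : α) (C : Finset α) => e ∉ C) e).card =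
        {X : Set α | X ⊆ M.E ∧ X.ncard = 4 ∧ (M.IsCircuit X ∧ e ∉ X)}.ncard := by
      rw [ncard_family_eq_card_filter M 4 (fun X => M.IsCircuit X ∧ e ∉ X)]
      congr 1
      ext C
      rw [Finset.mem_bipartiteAbove, h𝒞, Finset.mem_filter, Finset.mem_filter, Finset.mem_coe]
      tauto
    rw [hfam]
    have hsub : {X : Set α | X ⊆ M.E ∧ X.ncard = 4 ∧ (M.IsCircuit X ∧ e ∉ X)} ⊆
        {C : Set α | C ⊆ M.E \ {e} ∧ M.IsCircuit C ∧ C.ncard = 4} := by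
      rintro X ⟨hXE, hX4, hXc, heX⟩
      exact ⟨fun x hx => ⟨hXE hx, fun hxe => heX (by rw [mem_singleton_iff.mp hxe] at hx; exact hx)⟩, hXc, hX4⟩
    -- `E ∖ {e}` has the rank of `E` (no coloop) and nullity `ν − 1`
    have hrk : M.eRk (M.E \ {e}) = M.eRk M.E := eRk_sdiff_singleton_eq_of_not_isColoop M heE (hK e)
    have hnull : (M.E \ {e}).ncard ≤ (M.eRk (M.E \ {e})).toNat + (ν - 1) := by
      rw [hrk]
      have h1 := Set.ncard_sdiff_add_ncard_of_subset (singleton_subset_iff.mpr heE) hEfin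
      rw [Set.ncard_singleton] at h1
      omega
    have hcap := ncard_isCircuit_ncard_eq_le M (ν := ν - 1) (k := 4) (by norm_num)
      (sdiff_subset : M.E \ {e} ⊆ M.E) hnull
    have hmono : (ν - 1 + 4 - 1).choose 4 ≤ (ν + 2).choose 4 := by
      rcases Nat.eq_zero_or_pos ν with hν | hν
      · subst hν; decide
      · exact Nat.choose_le_choose 4 (show ν - 1 + 4 - 1 ≤ ν + 2 by omega)
    exact ((Set.ncard_le_ncard hsub (hEfin.finite_subsets.subset (fun X hX => hX.1.trans sdiff_subset))).trans
      hcap).trans hmono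
  have hsumR : ∑ C ∈ 𝒞, (E'.bipartiteBelow (fun (e : α) (C : Finset α) => e ∉ C) C).card =
      𝒞.card * (E'.card - 4) := by
    rw [Finset.sum_congr rfl hR, Finset.sum_const, smul_eq_mul]
  have hsumL : ∑ e ∈ E', (𝒞.bipartiteAbove (fun (e : α) (C : Finset α) => e ∉ C) e).card ≤
      E'.card * (ν + 2).choose 4 := by
    calc ∑ e ∈ E', (𝒞.bipartiteAbove (fun (e : α) (C : Finset α) => e ∉ C) e).card
        ≤ ∑ _e ∈ E', (ν + 2).choose 4 := Finset.sum_le_sum hL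
      _ = E'.card * (ν + 2).choose 4 := by rw [Finset.sum_const, smul_eq_mul]
  rw [key, hsumR] at hsumL
  rw [mul_comm]
  exact hsumL

/-- `c₄ ≤ ⌊n·C(ν + 2, 4)/(n − 4)⌋` for a coloop-free matroid of nullity `ν` on `n > 4` points. -/
theorem ncard_fourCircuits_le_div (M : Matroid α) [M.Finite] (hK : ∀ e, ¬ M.IsColoop e) {ν : ℕ}
    (hd : M.E.encard = M.eRank + (ν : ℕ∞)) (hn : 4 < M.E.ncard) :
    {X : Set α | X ⊆ M.E ∧ X.ncard = 4 ∧ M.IsCircuit X}.ncard ≤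
      M.E.ncard * (ν + 2).choose 4 / (M.E.ncard - 4) := by
  rw [Nat.le_div_iff_mul_le (by omega)]
  have := mul_ncard_fourCircuits_le M hK hd
  rw [mul_comm] at this
  exact this

/-- The two spellings of the `4`-circuit family have the same count. -/
theorem ncard_fourCircuits_comm (M : Matroid α) [M.Finite] :
    {C : Set α | C ⊆ M.E ∧ M.IsCircuit C ∧ C.ncard = 4}.ncard =
      {X : Set α | X ⊆ M.E ∧ X.ncard = 4 ∧ M.IsCircuit X}.ncard := by
  congr 1
  ext X
  simp only [Set.mem_setOf_eq]
  tauto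

/-- **`D₄ ≤ (n − 3)·c₃ + c₄` without dependent pairs**, with `c₃ = #{3-sets of rank ≤ 2}` and `c₄` the `4`-circuits. -/
theorem ncard_four_eRk_le_three_le_add (M : Matroid α) [M.Finite]
    (h0 : {P : Set α | P ⊆ M.E ∧ P.ncard = 2 ∧ M.Dep P}.ncard = 0) :
    {X : Set α | X ⊆ M.E ∧ X.ncard = 4 ∧ M.eRk X ≤ 3}.ncard ≤
      (M.E.ncard - 3) * {X : Set α | X ⊆ M.E ∧ X.ncard = 3 ∧ M.eRk X ≤ 2}.ncard +
        {X : Set α | X ⊆ M.E ∧ X.ncard = 4 ∧ M.IsCircuit X}.ncard := by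
  have hEfin := M.ground_finite
  have hs := ncard_dep_four_le_split_general M
  rw [h0, mul_zero, zero_add, ncard_fourCircuits_comm] at hs
  -- every `3`-circuit is a `3`-set of rank `≤ 2`
  have hc3 : {C : Set α | C ⊆ M.E ∧ M.IsCircuit C ∧ C.ncard = 3}.ncard ≤
      {X : Set α | X ⊆ M.E ∧ X.ncard = 3 ∧ M.eRk X ≤ 2}.ncard := by
    refine Set.ncard_le_ncard ?_ (hEfin.finite_subsets.subset (fun X hX => hX.1))
    rintro C ⟨hCE, hCc, hC3⟩
    refine ⟨hCE, hC3, ?_⟩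
    have hCfin : C.Finite := hEfin.subset hCE
    have hdep : M.eRk C < C.encard := (Matroid.eRk_lt_encard_iff_dep_of_finite hCfin hCE).mpr hCc.dep
    rw [← hCfin.cast_ncard_eq, hC3] at hdep
    have h3 : M.eRk C ≠ ⊤ := ((M.eRk_le_encard C).trans_lt hCfin.encard_lt_top).ne
    rw [← S1.coe_toNat_eRk M hCE] at hdep ⊢
    have : (M.eRk C).toNat < 3 := by exact_mod_cast hdep
    exact_mod_cast (by omega : (M.eRk C).toNat ≤ 2)
  have hsub := Set.ncard_le_ncard (four_eRk_le_three_subset_dep M)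
    (hEfin.finite_subsets.subset (fun X hX => hX.1))
  have hc3' := Nat.mul_le_mul_left (M.E.ncard - 3) hc3
  omega

/-- **`4·Q₄² ≤ (ν − 2)·c₃` without dependent pairs** (`2 < rk E`), `c₃ = #{3-sets of rank ≤ 2}`. -/
theorem four_mul_ncard_four_eRk_le_two_le_mul (M : Matroid α) [M.Finite] (hK : ∀ e, ¬ M.IsColoop e)
    {ν : ℕ} (hd : M.E.encard = M.eRank + (ν : ℕ∞))
    (h0 : {P : Set α | P ⊆ M.E ∧ P.ncard = 2 ∧ M.Dep P}.ncard = 0) (hs : 2 < (M.eRk M.E).toNat) :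
    4 * {X : Set α | X ⊆ M.E ∧ X.ncard = 4 ∧ M.eRk X ≤ 2}.ncard ≤
      (ν - 2) * {X : Set α | X ⊆ M.E ∧ X.ncard = 3 ∧ M.eRk X ≤ 2}.ncard := by
  have hEfin := M.ground_finite
  have hdc := mul_ncard_le_of_eRk M hK hd (k := 4) (s := 2) (by norm_num) (by norm_num) hs
  have h31 : {Y : Set α | Y ⊆ M.E ∧ Y.ncard = 4 - 1 ∧ M.eRk Y ≤ ((2 - 1 : ℕ) : ℕ∞)}.ncard = 0 := by
    have := ncard_three_eRk_le_one_eq_zero_of_no_dep_pair M h0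
    simpa using this
  have hex : {Y : Set α | Y ⊆ M.E ∧ Y.ncard = 4 - 1 ∧ M.eRk Y = 2}.ncard ≤
      {X : Set α | X ⊆ M.E ∧ X.ncard = 3 ∧ M.eRk X ≤ 2}.ncard := by
    refine Set.ncard_le_ncard ?_ (hEfin.finite_subsets.subset (fun X hX => hX.1))
    intro Y hY
    exact ⟨hY.1, by simpa using hY.2.1, le_of_eq hY.2.2⟩
  rw [h31, mul_zero, add_zero] at hdc
  rw [show 2 + ν - 4 = ν - 2 by omega] at hdc
  exact hdc.trans (Nat.mul_le_mul_left _ hex)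

/-- `#{X ⊆ E : |X| = 4} = C(n, 4)`. -/
theorem ncard_four_subsets_eq_choose (M : Matroid α) [M.Finite] :
    {X : Set α | X ⊆ M.E ∧ X.ncard = 4 ∧ True}.ncard = M.E.ncard.choose 4 := by
  classical
  rw [ncard_family_eq_card_filter M 4 (fun _ => True)]
  rw [Finset.filter_true_of_mem (fun _ _ => trivial), Finset.card_powersetCard,
    Set.ncard_eq_toFinset_card M.E M.ground_finite]

/-- The `4`-sets of rank `4` are the `4`-sets that are not of rank `≤ 3`: `#{rk = 4} + D₄ = C(n, 4)`. -/
theorem ncard_four_eRk_eq_four_add (M : Matroid α) [M.Finite] :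
    {Y : Set α | Y ⊆ M.E ∧ Y.ncard = 4 ∧ M.eRk Y = 4}.ncard +
      {X : Set α | X ⊆ M.E ∧ X.ncard = 4 ∧ M.eRk X ≤ 3}.ncard = M.E.ncard.choose 4 := by
  classical
  have hEfin := M.ground_finite
  rw [← ncard_four_subsets_eq_choose M]
  have hfin : {X : Set α | X ⊆ M.E ∧ X.ncard = 4 ∧ True}.Finite :=
    hEfin.finite_subsets.subset (fun X hX => hX.1)
  rw [← Set.ncard_union_add_ncard_inter _ _ (hfin.subset (fun Y hY => ⟨hY.1, hY.2.1, trivial⟩))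
    (hfin.subset (fun Y hY => ⟨hY.1, hY.2.1, trivial⟩))]
  have hdisj : {Y : Set α | Y ⊆ M.E ∧ Y.ncard = 4 ∧ M.eRk Y = 4} ∩
      {X : Set α | X ⊆ M.E ∧ X.ncard = 4 ∧ M.eRk X ≤ 3} = ∅ := by
    rw [Set.eq_empty_iff_forall_notMem]
    rintro Y ⟨⟨-, -, h4⟩, ⟨-, -, h3⟩⟩
    rw [h4] at h3
    exact absurd h3 (by norm_num)
  rw [hdisj, Set.ncard_empty, add_zero]
  congr 1
  ext Y
  simp only [Set.mem_union, Set.mem_setOf_eq, and_true]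
  constructor
  · rintro (⟨h1, h2, -⟩ | ⟨h1, h2, -⟩) <;> exact ⟨h1, h2⟩
  · rintro ⟨hYE, hY4⟩
    have hYfin : Y.Finite := hEfin.subset hYE
    have hle : M.eRk Y ≤ 4 := by
      have := M.eRk_le_encard Y
      rwa [← hYfin.cast_ncard_eq, hY4] at this
    rcases eq_or_lt_of_le hle with h | h
    · exact Or.inl ⟨hYE, hY4, h⟩
    · right
      refine ⟨hYE, hY4, ?_⟩
      rw [← S1.coe_toNat_eRk M hYE] at h ⊢
      have : (M.eRk Y).toNat < 4 := by exact_mod_cast h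
      exact_mod_cast (by omega : (M.eRk Y).toNat ≤ 3)

/-- **`5·Q₅⁴ ≤ (ν − 1)·(C(n, 4) − D₄) + (n − 4)·D₄`** (coloop-free, nullity `ν`, `4 < rk E`): the raw double count
with the rank-`4` `4`-sets counted exactly. -/
theorem five_mul_ncard_five_eRk_le_four_le_exact (M : Matroid α) [M.Finite] (hK : ∀ e, ¬ M.IsColoop e)
    {ν : ℕ} (hd : M.E.encard = M.eRank + (ν : ℕ∞)) (hs : 4 < (M.eRk M.E).toNat) :
    5 * {X : Set α | X ⊆ M.E ∧ X.ncard = 5 ∧ M.eRk X ≤ 4}.ncard ≤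
      (ν - 1) * (M.E.ncard.choose 4 - {X : Set α | X ⊆ M.E ∧ X.ncard = 4 ∧ M.eRk X ≤ 3}.ncard) +
        (M.E.ncard - 4) * {X : Set α | X ⊆ M.E ∧ X.ncard = 4 ∧ M.eRk X ≤ 3}.ncard := by
  have hdc := mul_ncard_le_of_eRk M hK hd (k := 5) (s := 4) (by norm_num) (by norm_num) hs
  rw [show 4 + ν - 5 = ν - 1 by omega, show (5 : ℕ) - 1 = 4 by norm_num,
    show ((4 - 1 : ℕ) : ℕ∞) = (3 : ℕ∞) by norm_num] at hdc
  simp only [Nat.cast_ofNat] at hdc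
  have hex : {Y : Set α | Y ⊆ M.E ∧ Y.ncard = 4 ∧ M.eRk Y = 4}.ncard =
      M.E.ncard.choose 4 - {X : Set α | X ⊆ M.E ∧ X.ncard = 4 ∧ M.eRk X ≤ 3}.ncard := by
    have := ncard_four_eRk_eq_four_add M
    omega
  rw [hex] at hdc
  exact hdc

end S1CFG

end PercRepro
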